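import Summits.BirchSwinnertonDyer.BirchSwinnertonDyer.Theses.SylvesterTwoHeegnerIndex
import Summits.BirchSwinnertonDyer.BirchSwinnertonDyer.Theorems.SylvesterTwoHeegnerIndexLowerSplit
import HarnessLib

/-!
# Route `SylvesterTwoHeegnerIndex` (rung K7t): GLUE of the by-name split of item 19477

HONEST FRAMING (cell bsd-cm): BSD is NOT proved by any of this; a closed item closes a rung-internal
statement, never the summit. This file closes the GLUE item `HeegnerIndexLowerOfPartsHSY`
(`LowerOnV0HSY → LowerOffV0HSY → HeegnerIndexLowerAtTwoHSYOfFacts`) of the by-name split of the crux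
19477 `HeegnerIndexLowerAtTwoHSYOfFacts` (planner bsd-cm-plan g20, rev 18), by ONE application of the
landed package `Theorems.SylvesterTwoLowerSplit.lowerOfFacts_of_onV0_of_offV0` (p471972, k7t-c3 g6),
whose companion `lowerOfFacts_iff_onV0_and_offV0` proves the split lossless. The two children stay open.
Books nothing as known; moves no label; no `sorry`.
References: [HuShuYin2019] Thm. 1.4, Thm. 1.6 (2), (1.3); [GrossZagier1986] Thm. I.6.3; [Kolyvagin1990].
-/

set_option linter.dupNamespace false

namespace Summit.BirchSwinnertonDyer.BirchSwinnertonDyer.Theorems.SylvesterTwoLowerOfParts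

open Summit.BirchSwinnertonDyer.BirchSwinnertonDyer.Theses.SylvesterTwoHeegnerIndex

/-- **Glue of the 19477 split holds** (one line over p471972).
[cite: HuShuYin2019, Thm. 1.4 and Thm. 1.6 (2)] [cite: GrossZagier1986, Thm. I.6.3] -/
theorem heegnerIndexLowerOfPartsHSY_proof : HeegnerIndexLowerOfPartsHSY :=
  fun hon hoff => Theorems.SylvesterTwoLowerSplit.lowerOfFacts_of_onV0_of_offV0 hon hoff

end Summit.BirchSwinnertonDyer.BirchSwinnertonDyer.Theorems.SylvesterTwoLowerOfParts
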